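import Mathlib
import HarnessLib
import Summits.CriticalPhenomena.SAWScalingLimit.Theses.SAWTotalPositivity
import Summits.CriticalPhenomena.SAWScalingLimit.Theses.SAWLeftRightFKG
import Summits.CriticalPhenomena.SAWScalingLimit.Theses.SAWTargetMonotonicity
import Literature.Probability.RandomPlanarGeometry.SAWRenewalBound

/-!
# Sketch — crux-ideate stmt-CriticalPhenomena-7115 (BoundaryTP2), ideator 1, round 1

First-lemma signatures of the two idea cards (they need not be proved here; they must elaborate).

* Card `ear-surgery-hug-covariance`: `HugCovariance` (one polymer, two end events), the two-edge
  outer form `TwoEdgeOuterTP2` of the crux, and the bridge lemmas (as `Prop`s / implications).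
* Card `renewal-cauchy-binet-kesten-budget`: `SingleCrossingCB` (the single-renewal sector inherits
  TP₂ from the two halves by the basic composition formula) and `KraftBudget` (every finite set of
  irreducible bridges has critical mass ≤ 1, from the PROVED `le_connectiveConstant_of_kraft`).
-/

namespace Summit.CriticalPhenomena.SAWScalingLimit.Cruxes.BoundaryTP2.Sketch

open Literature.Probability.RandomPlanarGeometry Literature.Probability.LatticeModels
open scoped ENNReal

/-- Card 1, C⁺ (equivalent form of the crux on outer two-edge instances): for a chordal SAW `a → b`
of `Ω_δ` whose source `a` has exactly the two neighbours `l, r` and whose target `b` has exactly the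
two neighbours `y, z`, with `r` and `y` on the same side (interlacing of `{r,z}` with `{l,y}` plus the
two realisability provisos of `BoundaryTP2`), the events "first step to `r`" and "last step from `y`"
are positively correlated under `SAW.weight Ω δ a b`. By the 2×2 odds-ratio identity this is exactly
`Z'(r,y) Z'(l,z) ≥ Z'(r,z) Z'(l,y)` in `Ω_δ ∖ {a,b}`, i.e. TP₂ (nested ≥ crossing). -/
def HugCovariance : Prop :=
  ∀ (Ω : Set ℂ) (δ : ℝ) (a b l r y z : Site 2), Bornology.IsBounded Ω → 0 < δ →
    (discreteDomainGraph Ω δ).Adj a l → (discreteDomainGraph Ω δ).Adj a r → l ≠ r →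
    (∀ w, (discreteDomainGraph Ω δ).Adj a w → w = l ∨ w = r) →
    (discreteDomainGraph Ω δ).Adj b y → (discreteDomainGraph Ω δ).Adj b z → y ≠ z →
    (∀ w, (discreteDomainGraph Ω δ).Adj b w → w = y ∨ w = z) →
    (∀ (P : SAW.DomainSAW Ω δ r z) (Q : SAW.DomainSAW Ω δ l y),
        ∃ v, v ∈ P.walk.support ∧ v ∈ Q.walk.support) →
    (∃ (P : SAW.DomainSAW Ω δ r y) (Q : SAW.DomainSAW Ω δ l z),
        List.Disjoint P.walk.support Q.walk.support) →
    (∃ (P : SAW.DomainSAW Ω δ r l) (Q : SAW.DomainSAW Ω δ y z),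
        a ∉ P.walk.support ∧ b ∉ Q.walk.support ∧ List.Disjoint P.walk.support Q.walk.support) →
    SAW.weight Ω δ a b {γ | γ.walk.getVert 1 = r} *
        SAW.weight Ω δ a b {γ | γ.walk.getVert (γ.length - 1) = y} ≤
      SAW.weight Ω δ a b Set.univ *
        SAW.weight Ω δ a b {γ | γ.walk.getVert 1 = r ∧ γ.walk.getVert (γ.length - 1) = y}

/-- Card 1, the crux localised (Fekete chaining) to two OUTER boundary edges: `BoundaryTP2`
restricted to quadruples with `p₄ ∼ p₁`, `p₂ ∼ p₃` and an exterior unit square hanging on each of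
these two edges (room for the ears). -/
def TwoEdgeOuterTP2 : Prop :=
  ∀ (Ω : Set ℂ) (δ : ℝ) (p₁ p₂ p₃ p₄ s₁ s₂ t₁ t₂ : Site 2), Bornology.IsBounded Ω →
    SimplyConnectedSpace Ω → 0 < δ →
    (discreteDomainGraph Ω δ).Adj p₄ p₁ → (discreteDomainGraph Ω δ).Adj p₂ p₃ →
    s₁ ∉ meshDomain Ω δ → s₂ ∉ meshDomain Ω δ →
    (zdGraph 2).Adj p₄ s₁ → (zdGraph 2).Adj s₁ s₂ → (zdGraph 2).Adj s₂ p₁ →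
    t₁ ∉ meshDomain Ω δ → t₂ ∉ meshDomain Ω δ →
    (zdGraph 2).Adj p₂ t₁ → (zdGraph 2).Adj t₁ t₂ → (zdGraph 2).Adj t₂ p₃ →
    (∀ (P : SAW.DomainSAW Ω δ p₁ p₃) (Q : SAW.DomainSAW Ω δ p₂ p₄),
        ∃ v, v ∈ P.walk.support ∧ v ∈ Q.walk.support) →
    (∃ (P : SAW.DomainSAW Ω δ p₁ p₂) (Q : SAW.DomainSAW Ω δ p₃ p₄),
        List.Disjoint P.walk.support Q.walk.support) →
    (∃ (P : SAW.DomainSAW Ω δ p₁ p₄) (Q : SAW.DomainSAW Ω δ p₂ p₃),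
        List.Disjoint P.walk.support Q.walk.support) →
    SAW.weight Ω δ p₁ p₃ Set.univ * SAW.weight Ω δ p₂ p₄ Set.univ ≤
      SAW.weight Ω δ p₁ p₂ Set.univ * SAW.weight Ω δ p₃ p₄ Set.univ

/-- Card 1, first lemma (a): ear surgery — the hug covariance gives the two-edge outer form. -/
def FirstLemma_EarSurgery : Prop := HugCovariance → TwoEdgeOuterTP2

/-- Card 1, first lemma (b): the crux itself implies the hug covariance (easy converse; together
with (a) and Fekete chaining, `HugCovariance` is the crux on outer faces). -/
def FirstLemma_HugOfTP2 : Prop :=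
  Summit.CriticalPhenomena.SAWScalingLimit.Theses.SAWTotalPositivity.BoundaryTP2 → HugCovariance

/-- Card 1, imports from the sibling routes: either sibling crux gives the hug covariance on the
domains it covers (two hull events for `LeftRightFKG`; the first-step event for `TargetMonotone`).
Typed here as bare implications between the route `Prop`s; the honest provable forms restrict
`HugCovariance` to polygon domains `{wind C ≠ 0}`. -/
def Import_FromLeftRightFKG : Prop :=
  Summit.CriticalPhenomena.SAWScalingLimit.Theses.SAWLeftRightFKG.LeftRightFKG → HugCovariance

def Import_FromTargetMonotone : Prop :=
  Summit.CriticalPhenomena.SAWScalingLimit.Theses.SAWTargetMonotonicity.TargetMonotone →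
    HugCovariance

/-- Number of steps of `γ` across the horizontal cut between rows `c` and `c + 1`. -/
noncomputable def crossings {Ω : Set ℂ} {δ : ℝ} {a b : Site 2} (c : ℤ)
    (γ : SAW.DomainSAW Ω δ a b) : ℕ :=
  (List.range γ.length).countP fun i =>
    ((γ.walk.getVert i) 1 = c ∧ (γ.walk.getVert (i + 1)) 1 = c + 1) ∨
      ((γ.walk.getVert i) 1 = c + 1 ∧ (γ.walk.getVert (i + 1)) 1 = c)

/-- Card 2, first lemma: the SINGLE-RENEWAL sector inherits TP₂ from the two halves (basic
composition formula / Cauchy–Binet). `Ω⁻, Ω⁺` are the parts of `Ω` below/above the cut (typed as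
hypotheses on their discrete domains to sidestep the largest-component convention); sources
`r ∼ r⁺` below, targets `y⁺, y` above, cut columns ordered by the first coordinate. Hypotheses:
TP₂ of the lower kernel towards the cut row and of the upper kernel from the cut row (instances of
the crux for the two SMALLER domains); conclusion: nested ≥ crossing for the weights restricted to
walks crossing the cut exactly once. -/
def SingleCrossingCB : Prop :=
  ∀ (Ω Ωl Ωu : Set ℂ) (δ : ℝ) (c : ℤ) (r r' y y' : Site 2), Bornology.IsBounded Ω → 0 < δ →
    Ωl = Ω ∩ {w : ℂ | w.im < δ * ((c : ℝ) + 1 / 2)} →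
    Ωu = Ω ∩ {w : ℂ | δ * ((c : ℝ) + 1 / 2) < w.im} →
    meshDomain Ωl δ = meshDomain Ω δ ∩ {v | v 1 ≤ c} →
    meshDomain Ωu δ = meshDomain Ω δ ∩ {v | c + 1 ≤ v 1} →
    r 1 ≤ c → r' 1 ≤ c → c + 1 ≤ y 1 → c + 1 ≤ y' 1 →
    (∀ ρ ρ' : ℤ, ρ < ρ' →
      SAW.weight Ωl δ r ![ρ', c] Set.univ * SAW.weight Ωl δ r' ![ρ, c] Set.univ ≤
        SAW.weight Ωl δ r ![ρ, c] Set.univ * SAW.weight Ωl δ r' ![ρ', c] Set.univ) →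
    (∀ ρ ρ' : ℤ, ρ < ρ' →
      SAW.weight Ωu δ ![ρ, c + 1] y Set.univ * SAW.weight Ωu δ ![ρ', c + 1] y' Set.univ ≤
        SAW.weight Ωu δ ![ρ, c + 1] y' Set.univ * SAW.weight Ωu δ ![ρ', c + 1] y Set.univ) →
    SAW.weight Ω δ r y {γ | crossings c γ = 1} * SAW.weight Ω δ r' y' {γ | crossings c γ = 1} ≤
      SAW.weight Ω δ r y' {γ | crossings c γ = 1} * SAW.weight Ω δ r' y {γ | crossings c γ = 1}

/-- Card 2, the budget: every finite set of irreducible bridges has critical mass `≤ 1`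
(Kesten's `A(x_c) = 1`, truncated; from the PROVED `SAW.Renewal.le_connectiveConstant_of_kraft`
by adjoining the one-step bridge and letting `ρ ↓ μ`). -/
def KraftBudget : Prop :=
  ∀ S : Finset (List SAW.Step), SAW.Renewal.Admissible S →
    ∑ s ∈ S, SAW.criticalFugacity ^ s.length ≤ 1

/-- Card 2, the natural output of any budget argument: TP₂ on the whole interval `[0, x_c]`
(fugacity-`x` weights typed inline as in `EdgeOfPositivity`), two-edge outer form. -/
def SubcriticalTwoEdgeTP2 : Prop :=
  ∀ x : ℝ, 0 ≤ x → x ≤ SAW.criticalFugacity →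
  ∀ (Ω : Set ℂ) (δ : ℝ) (p₁ p₂ p₃ p₄ : Site 2), Bornology.IsBounded Ω →
    SimplyConnectedSpace Ω → 0 < δ →
    (discreteDomainGraph Ω δ).Adj p₄ p₁ → (discreteDomainGraph Ω δ).Adj p₂ p₃ →
    (∀ (P : SAW.DomainSAW Ω δ p₁ p₃) (Q : SAW.DomainSAW Ω δ p₂ p₄),
        ∃ v, v ∈ P.walk.support ∧ v ∈ Q.walk.support) →
    (∃ (P : SAW.DomainSAW Ω δ p₁ p₂) (Q : SAW.DomainSAW Ω δ p₃ p₄),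
        List.Disjoint P.walk.support Q.walk.support) →
    (∃ (P : SAW.DomainSAW Ω δ p₁ p₄) (Q : SAW.DomainSAW Ω δ p₂ p₃),
        List.Disjoint P.walk.support Q.walk.support) →
    (∑' γ : SAW.DomainSAW Ω δ p₁ p₃, ENNReal.ofReal (x ^ γ.length)) *
        (∑' γ : SAW.DomainSAW Ω δ p₂ p₄, ENNReal.ofReal (x ^ γ.length)) ≤
      (∑' γ : SAW.DomainSAW Ω δ p₁ p₂, ENNReal.ofReal (x ^ γ.length)) *
        (∑' γ : SAW.DomainSAW Ω δ p₃ p₄, ENNReal.ofReal (x ^ γ.length))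

/-- `KraftBudget` HOLDS (proved here from the tree's `le_connectiveConstant_of_kraft`): adjoin the
one-step bridge, and if the critical mass exceeded `1`, continuity of the finite sum would give a
fugacity `t < x_c` with mass `≥ 1`, i.e. `t⁻¹ ≤ μ` by Kesten's renewal bound — contradicting
`t⁻¹ > x_c⁻¹ = μ`. -/
theorem kraftBudget_holds : KraftBudget := by
  intro S hS
  classical
  set S' : Finset (List SAW.Step) := insert [(0 : SAW.Step)] S with hS'def
  have hS'adm : SAW.Renewal.Admissible S' := by
    intro s hs
    rcases Finset.mem_insert.mp hs with rfl | hs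
    · exact SAW.Renewal.isIrrBridge_single
    · exact hS s hs
  have hE : [(0 : SAW.Step)] ∈ S' := Finset.mem_insert_self _ _
  have hμ : (0 : ℝ) < SAW.connectiveConstant := by
    rw [← SAW.Zd.connectiveConstant_two]; exact SAW.Zd.connectiveConstant_pos 2
  have hxc : (0 : ℝ) < SAW.criticalFugacity := by
    unfold SAW.criticalFugacity; exact inv_pos.mpr hμ
  have hsub : ∑ s ∈ S, SAW.criticalFugacity ^ s.length ≤
      ∑ s ∈ S', SAW.criticalFugacity ^ s.length :=
    Finset.sum_le_sum_of_subset_of_nonneg (Finset.subset_insert _ _)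
      (fun _ _ _ => pow_nonneg hxc.le _)
  refine hsub.trans ?_
  by_contra h
  push Not at h
  -- the polynomial g(t) = Σ t^{|s|} is continuous; g(x_c) > 1 gives g(t) > 1 for some 0 < t < x_c
  set g : ℝ → ℝ := fun t => ∑ s ∈ S', t ^ s.length with hgdef
  have hcont : Continuous g := by
    rw [hgdef]; fun_prop
  have hev : ∀ᶠ t in nhds SAW.criticalFugacity, 1 < g t :=
    hcont.continuousAt.eventually (lt_mem_nhds (by simpa [hgdef] using h))
  obtain ⟨ε, hεpos, hε⟩ := Metric.eventually_nhds_iff.mp hev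
  set t : ℝ := SAW.criticalFugacity - min (ε / 2) (SAW.criticalFugacity / 2) with htdef
  have hmin_pos : 0 < min (ε / 2) (SAW.criticalFugacity / 2) := lt_min (by linarith) (by linarith)
  have ht_pos : 0 < t := by
    have : min (ε / 2) (SAW.criticalFugacity / 2) ≤ SAW.criticalFugacity / 2 := min_le_right _ _
    rw [htdef]; linarith
  have ht_lt : t < SAW.criticalFugacity := by rw [htdef]; linarith
  have ht_dist : dist t SAW.criticalFugacity < ε := by
    rw [Real.dist_eq, abs_sub_comm, abs_of_nonneg (by linarith)]
    have : min (ε / 2) (SAW.criticalFugacity / 2) ≤ ε / 2 := min_le_left _ _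
    rw [htdef]; linarith
  have hgt : 1 < g t := hε ht_dist
  -- Kesten's renewal bound at ρ = t⁻¹
  have hK : 1 ≤ ∑ s ∈ S', (t⁻¹)⁻¹ ^ s.length := by
    rw [inv_inv]; exact hgt.le
  have hρle : t⁻¹ ≤ SAW.connectiveConstant :=
    SAW.Renewal.le_connectiveConstant_of_kraft hS'adm hE (inv_pos.mpr ht_pos) hK
  have hρgt : SAW.connectiveConstant < t⁻¹ := by
    have : SAW.criticalFugacity⁻¹ < t⁻¹ := (inv_lt_inv₀ hxc ht_pos).mpr ht_lt
    simpa [SAW.criticalFugacity, inv_inv] using this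
  exact absurd hρle (not_le.mpr hρgt)

/-- Card 3 (`infinite-room-injection`), first lemma / conjecture mined this session: in the upper
HALF-PLANE `ℍ = {Im ≥ 0}` (mesh `1`), for the two boundary edges `{(0,0),(1,0)}` and `{(m,0),(m+1,0)}`
(`m ≥ 1`), the number of RAINBOW pairs (SAWs `0 → m+1` and `1 → m`) of total length `n` is at least
the number of CROSSING pairs (`0 → m`, `1 → m+1`) of total length `n`, for every `n` — coefficientwise
log-convexity of the half-plane boundary kernel `h(m) = Σ_γ x^{|γ|}`; equivalently a length-preserving
injection crossing ↦ rainbow exists. (Data: kit j006051 — no negative coefficient through total length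
19–23 for m = 1…5; infinite strips of height H turn negative at length 6, 10, 16, 22, >24 for
H = 2…6.) -/
def HalfPlaneCoeffTP2 : Prop :=
  let ℍ : Set ℂ := {z | 0 ≤ z.im}
  ∀ m n : ℕ, 1 ≤ m →
    Nat.card {pq : SAW.DomainSAW ℍ 1 ![0, 0] ![(m : ℤ), 0] × SAW.DomainSAW ℍ 1 ![1, 0] ![(m : ℤ) + 1, 0] //
        pq.1.length + pq.2.length = n} ≤
      Nat.card {pq : SAW.DomainSAW ℍ 1 ![0, 0] ![(m : ℤ) + 1, 0] × SAW.DomainSAW ℍ 1 ![1, 0] ![(m : ℤ), 0] //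
        pq.1.length + pq.2.length = n}

end Summit.CriticalPhenomena.SAWScalingLimit.Cruxes.BoundaryTP2.Sketch
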